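/-
Copyright: lit-balaban Phase-2 proof seat p27 (gen 32).  Statement-level skeleton of a published paper; no proof claims beyond what the
kernel checks below.
-/
import Literature.MathematicalPhysics.QuantumFieldTheory.Balaban1983to89.B3Eq317ZeroTorus
import Literature.MathematicalPhysics.QuantumFieldTheory.BalabanImbrieJaffe1984to88.BIJ85FreeResolventTorus

/-!
# [BalabanImbrieJaffe1985] §7.3, p. 326 — the SUP-NORM decay of `G_k(u) = [D_u^*D_u + a_kQ_k(u)^*Q_k(u)]⁻¹` at NON-FLAT small fields,
# kernel file 2 of 3: the EXPONENTIALLY TILTED ROW BOUNDS `Σ_z e^{2t|x−z|_∞/L^k}G_k(T_ε,0)(z,x)² ≤ C₁(L^kε)⁴L^{−kd}` (flat block propagator)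
# and `Σ_z e^{2t|x−z|_∞/L^k}R(x,z)² ≤ C₀(L^kε)⁴L^{−kd}` (free massive resolvent, `m = (L^kε)^{−2}`), `d ≤ 3`, `k`-uniform

T. Bałaban, J. Imbrie, A. Jaffe, Commun. Math. Phys. **97** (1985) 299–329 [BalabanImbrieJaffe1985], §7.3 p. 326 [PDF 28] (the decay
sentence, row **C1.Eq7.3.1-7.3.2** of `HOME/lit-balaban-r15/ROWS-C1.md`, owner r15); the INPUT is [Balaban1983Higgs3] (2.10) — the multiscale
zero-field kernel bounds `|G^η_{(i)}(z,x)| ≤ C(L^iε)^{2−d}e^{−δ|z−x|/L^i}` on the torus, LANDED in the tree as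
`Balaban1983to89.B3Sect3KernelsZeroTorus.gpiece_bounds` (p20) with the resummation `Σ_{i<k}G_{(i)} = G_k(T_ε,0)` (`sum_gpiece_eq_G`).

statement-level skeleton of published theorems with citation tags; proofs where landed; nothing here is a claim about the Yang–Mills mass gap

PDF held: `paper:balaban1985-cmp97-bij-higgs-minimizers` (p. 326 = PDF 28); text layer re-read this session.  CITATION HEADER, PRINTED TEXT
and MECHANISM: see file 1 `BIJ85FreeResolventTorus` (same seat, same TAKING line HOME/STATUS.md 2026-08-22T19:09:49Z, free-target protocol
G.5-34(d), item 3 of `HOME/lit-balaban-r15/C1-CLOSURE.md` §5).  Kind «model-level theorems only» (no new definition, no `Prop`-valued fact).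

THE ARGUMENT OF THIS FILE.  (§6) For the flat block propagator `u = G_k(T_ε,0)δ_x = Σ_{i<k}G_{(i)}δ_x`:
`(Σ_i|G_{(i)}(z,x)|)² ≤ (Σ_iq^{−i})(Σ_iq^i|G_{(i)}(z,x)|²)`, `q = √(L^{4−d}) > 1` (`d ≤ 3`), and for `t ≤ δ/2`,
`e^{2t|x−z|/L^k} ≤ e^{δ|x−z|/L^i}` (`i < k`), so `Σ_ze^{2t|x−z|/L^k}G_{(i)}(z,x)² ≤ C²(L^iε)^{4−2d}Σ_ze^{−δ|z−x|/L^i} ≤ C²K_δ(L^iε)^{4−2d}L^{id}`;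
the scale identity `(L^iε)^{4−2d}L^{id}/q^i = ε^{4−2d}q^i` and the two geometric sums in `q` give `≤ C₁(L^kε)⁴L^{−kd}`.  (§7) For
`R = (−Δ^ε + m)⁻¹`, `m = (L^kε)^{−2}`: the resolvent identity of file 1 applied to `δ_x`, `Rδ_x = u + R(α_kQ_k^*Q_k − m)u`, the free Agmon
bound of file 1 for `R` in the weight `w = e^{t|x−·|/L^k}` (`κ₀(t) = dε^{−2}(t/L^k)²e^{t/L^k} ≤ m/2` for `t ≤ 1/(2d)`) and the tilted block
bound `Σ(wQ_k^*Q_ku)² ≤ e^{2t}Σ(wu)²` give `Σ_z(w(z)R(x,z))² ≤ 2Σ(wu)² + 2(2/m)²(2α_k²e^{2t} + 2m²)Σ(wu)² ≤ C₀(L^kε)⁴L^{−kd}`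
(`α_k = a_k(L^kε)^{−2} ≤ a·m`; `R` is symmetric).

WHAT IS PROVED (theorems only; 0 `sorry`; standard axioms; no new definition, no `Prop`-valued fact).
* §6 `sum_exp_neg_supDist_scale_le` (`Σ_ze^{−δ|x−z|_∞/L^i} ≤ (2(1 + d/δ))^d·L^{id}`), (private) `rpow_two_sub_natCast`, `one_lt_sqrt_pow`,
  `scale_identity`, **`tilted_row_G_sq_le`**.
* §7 (private) `add_sq_le_two`, `inv_H_apply_eq_mulVec_single`, **`tilted_row_R_sq_le`**: `∃ t₀ C₀ > 0` (from `d ≤ 3`, `L`, `a`) with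
  `Σ_z(e^{t|x−z|_∞/L^k}R(x,z))² ≤ C₀(L^kε)⁴L^{−kd}` for every volume, `1 ≤ k ≤ K`, `0 ≤ t ≤ t₀`, `x`.

HONEST SCOPE.  `d ≤ 3` only (at `d = 4` the scale sum `Σ_{i<k}L^{(4−d)i}` costs a factor `k`); free-lattice analysis (no gauge field); whole
fine torus; constants explicit and ours.  Nothing here is summit progress.  Unit `lit-balaban-p27` (literature-prover-lit-balaban-p27-g32-0),
HOME `run/shared/lean/pub/lit-balaban/`, 2026-08-22.
-/

open scoped BigOperators
open Finset Matrix

namespace Literature.MathematicalPhysics.QuantumFieldTheory.BalabanImbrieJaffe1984to88.BIJ85FreeResolventTiltedRow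

open Literature.MathematicalPhysics.QuantumFieldTheory.Balaban1983to89
open B1RG242Torus (H hOp deriv shiftMat tower)
open LatticeFieldCalculus (supDist shiftEquiv)
open BIJ85FreeResolventTorus

noncomputable section

variable {P : Params}

/-! ## §6 The tilted row bound of the flat block propagator from the zero-field kernel bounds (2.10) of [Balaban1983Higgs3]
(`B3Sect3KernelsZeroTorus.gpiece_bounds`), `d ≤ 3` -/

/-- kernel: `x^{2−d} = x²/x^d` for `x > 0` (the real power of `gpiece_bounds` as a quotient of natural powers). [folklore] -/
private theorem rpow_two_sub_natCast {x : ℝ} (hx : 0 < x) (d : ℕ) : x ^ ((2 : ℝ) - (d : ℝ)) = x ^ 2 / x ^ d := by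
  rw [Real.rpow_sub hx, Real.rpow_two, Real.rpow_natCast]

/-- kernel: the radial sum of the squared decay factor at scale `L^i`, uniform in the volume:
`Σ_z e^{−δ|x−z|_∞/L^i} ≤ (2(1 + d/δ))^d·L^{id}`. [cite: Balaban1983Higgs3, p.427] -/
theorem sum_exp_neg_supDist_scale_le {δ : ℝ} (hδ : 0 < δ) (i : ℕ) (x : Balaban1983to89.Site P 0) :
    ∑ z : Balaban1983to89.Site P 0, Real.exp (-(δ * (supDist x z : ℝ) / (P.L : ℝ) ^ i)) ≤
      (2 * (1 + P.d / δ)) ^ P.d * ((P.L : ℝ) ^ i) ^ P.d := by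
  have hLi : 1 ≤ (P.L : ℝ) ^ i := one_le_pow₀ (by exact_mod_cast P.L_pos)
  have hLipos : 0 < (P.L : ℝ) ^ i := by positivity
  have h := B3TorusRadialSums.sum_exp_neg_supDist_le (P := P) (j := 0) (a := δ / (P.L : ℝ) ^ i) (div_pos hδ hLipos) P.hd x
  have e : ∀ z : Balaban1983to89.Site P 0, Real.exp (-(δ * (supDist x z : ℝ) / (P.L : ℝ) ^ i)) =
      Real.exp (-(δ / (P.L : ℝ) ^ i * (supDist x z : ℝ))) := fun z => by congr 1; ring
  simp_rw [e]
  refine h.trans ?_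
  rw [← mul_pow]
  refine pow_le_pow_left₀ (by positivity) ?_ _
  have hdδ : 0 ≤ (P.d : ℝ) / δ := by positivity
  calc 2 * (1 + (P.d : ℝ) / (δ / (P.L : ℝ) ^ i)) = 2 * (1 + (P.d : ℝ) / δ * (P.L : ℝ) ^ i) := by field_simp
    _ ≤ 2 * ((1 + (P.d : ℝ) / δ) * (P.L : ℝ) ^ i) := by nlinarith
    _ = 2 * (1 + P.d / δ) * (P.L : ℝ) ^ i := by ring

/-- kernel: for `d ≤ 3` and `L ≥ 2` the ratio `q = √(L^{4−d})` of the scale sum exceeds `1`. [folklore] -/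
private theorem one_lt_sqrt_pow {L d : ℕ} (hL : 1 < L) (hd : d ≤ 3) : 1 < Real.sqrt ((L : ℝ) ^ (4 - d)) := by
  rw [show (1 : ℝ) = Real.sqrt 1 by rw [Real.sqrt_one]]
  refine Real.sqrt_lt_sqrt zero_le_one ?_
  have hL' : (1 : ℝ) < L := by exact_mod_cast hL
  exact one_lt_pow₀ hL' (by omega)

/-- kernel: the scale bookkeeping `(L^iε)⁴·L^{id}/((L^iε)^{2d}·q^i) = ε⁴ε^{−2d}·q^i` with `q² = L^{4−d}` (`d ≤ 4`). [folklore] -/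
private theorem scale_identity {L : ℝ} (hL : 0 < L) {ε : ℝ} (hε : 0 < ε) {d : ℕ} (hd : d ≤ 4) (i : ℕ) :
    ((L ^ i * ε) ^ 2 / (L ^ i * ε) ^ d) ^ 2 * (L ^ i) ^ d / (Real.sqrt (L ^ (4 - d))) ^ i =
      ε ^ 4 / ε ^ (2 * d) * (Real.sqrt (L ^ (4 - d))) ^ i := by
  set q := Real.sqrt (L ^ (4 - d)) with hq
  have hq2 : q ^ 2 = L ^ (4 - d) := by rw [hq, Real.sq_sqrt (pow_nonneg hL.le _)]
  have hqpos : 0 < q := Real.sqrt_pos.2 (pow_pos hL _)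
  have hL4 : L ^ (4 * i) = (q ^ 2) ^ i * (L ^ d) ^ i := by
    rw [hq2, ← pow_mul, ← pow_mul, ← pow_add]
    congr 1
    have : (4 - d) * i + d * i = 4 * i := by rw [← Nat.add_mul, Nat.sub_add_cancel hd]
    omega
  have hLi : 0 < L ^ i := pow_pos hL i
  have hεd : 0 < ε ^ d := pow_pos hε d
  have hLi4 : (L ^ i) ^ 4 = (q ^ 2) ^ i * (L ^ d) ^ i := by rw [← pow_mul, mul_comm i 4, hL4]
  field_simp
  rw [hLi4]
  ring

/-- **THE TILTED ROW BOUND OF THE FLAT BLOCK PROPAGATOR** (`d ≤ 3`): there are `t₁, C₁ > 0` (functions of `d, L, a`) with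
`Σ_z e^{2t|x−z|_∞/L^k}·G_k(T_ε,0)(z,x)² ≤ C₁(L^kε)⁴L^{−kd}` for every volume, every `1 ≤ k ≤ K`, every `0 ≤ t ≤ t₁` and every `x` — from the
multiscale kernel bounds `|G^η_{(i)}(z,x)| ≤ C(L^iε)^{2−d}e^{−δ|z−x|/L^i}` of [Balaban1983Higgs3] (2.10) (`B3Sect3KernelsZeroTorus.gpiece_bounds`)
by a weighted Cauchy–Schwarz over the scales `i < k` with weights `q^i`, `q = √(L^{4−d})`, and the radial sums `Σ_z e^{−δ|x−z|/L^i} ≤ K_δL^{id}`.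
[cite: BalabanImbrieJaffe1985, (7.3.2) p.326] -/
theorem tilted_row_G_sq_le (d L : ℕ) (hd : 1 ≤ d) (hd3 : d ≤ 3) (hL : Odd L ∧ 1 < L) {a : ℝ} (ha : 0 < a) :
    ∃ t₁ C₁ : ℝ, 0 < t₁ ∧ 0 < C₁ ∧ ∀ (P : Params), P.d = d → P.L = L →
      ∀ k : ℕ, 1 ≤ k → k ≤ P.K → ∀ t : ℝ, 0 ≤ t → t ≤ t₁ → ∀ x : Balaban1983to89.Site P 0,
        ∑ z, (Real.exp (t * (supDist x z : ℝ) / (P.L : ℝ) ^ k) * (tower P a 0).G k z x) ^ 2 ≤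
          C₁ * (P.spacing k ^ 4 / (P.L : ℝ) ^ (k * P.d)) := by
  obtain ⟨δ, C, hδ, hC, hgp⟩ := B3Sect3KernelsZeroTorus.gpiece_bounds d L hd hL ha (le_refl (0 : ℝ))
  set q : ℝ := Real.sqrt ((L : ℝ) ^ (4 - d)) with hq
  have hq1 : 1 < q := one_lt_sqrt_pow hL.2 hd3
  have hqpos : 0 < q := zero_lt_one.trans hq1
  set Kδ : ℝ := (2 * (1 + (d : ℝ) / δ)) ^ d with hKδ
  have hKδ_pos : 0 < Kδ := by positivity
  refine ⟨δ / 2, C ^ 2 * Kδ / (q - 1) ^ 2, by linarith, by have := sub_pos.2 hq1; positivity, ?_⟩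
  intro P hPd hPL k hk1 hkK t ht0 ht1 x
  have hk : k ≤ P.m + P.K := hkK.trans (Nat.le_add_left _ _)
  obtain ⟨hval, -, -, -⟩ := hgp P hPd hPL k hk1 hkK
  subst hPd; subst hPL
  have hLpos : (0 : ℝ) < P.L := P.cast_L_pos
  have hεpos : 0 < P.eps := P.eps_pos
  -- notation: the weight, the decay factors, the scale sum
  set w : Balaban1983to89.Site P 0 → ℝ := fun z => Real.exp (t * (supDist x z : ℝ) / (P.L : ℝ) ^ k) with hw
  set f : ℕ → Balaban1983to89.Site P 0 → ℝ := fun i z =>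
    P.spacing i ^ 2 / P.spacing i ^ P.d * Real.exp (-(δ / 2 * (supDist x z : ℝ) / (P.L : ℝ) ^ i)) with hf
  have hf_nn : ∀ i z, 0 ≤ f i z := fun i z => by
    simp only [hf]; exact mul_nonneg (div_nonneg (sq_nonneg _) (pow_nonneg (P.spacing_pos i).le _)) (Real.exp_pos _).le
  set Sq : ℝ := ∑ i ∈ range k, q ^ i with hSq
  have hSq_pos : 0 < Sq := by
    rw [hSq]; exact sum_pos (fun i _ => pow_pos hqpos i) ⟨0, mem_range.2 hk1⟩
  -- (P1) pointwise: `|w z·G(z,x)| ≤ ε^d·C·Σ_{i<k} f i z`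
  have hP1 : ∀ z : Balaban1983to89.Site P 0,
      |w z * (tower P a 0).G k z x| ≤ P.eps ^ P.d * C * ∑ i ∈ range k, f i z := by
    intro z
    have hG : (tower P a 0).G k z x = P.eps ^ P.d * ∑ i ∈ range k, B3Sect3KernelsZeroTorus.gpiece P a 0 k i z x := by
      have h := B3Eq317ZeroTorus.sum_gpiece_eq_G (P := P) ha le_rfl hk1 z x
      rw [B3Eq317ZeroTorus.sum_gpiece_apply] at h
      have hε : P.eps ^ P.d ≠ 0 := pow_ne_zero _ hεpos.ne'
      rw [h, ← mul_assoc, mul_inv_cancel₀ hε, one_mul]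
    have hwpos : 0 < w z := Real.exp_pos _
    have e0 : w z * (P.eps ^ P.d * ∑ i ∈ range k, B3Sect3KernelsZeroTorus.gpiece P a 0 k i z x) =
        P.eps ^ P.d * ∑ i ∈ range k, w z * B3Sect3KernelsZeroTorus.gpiece P a 0 k i z x := by rw [mul_sum, mul_sum, mul_sum]; exact sum_congr rfl fun i _ => by ring
    rw [hG, e0, abs_mul, abs_of_pos (pow_pos hεpos _), mul_assoc]
    refine mul_le_mul_of_nonneg_left ?_ (pow_nonneg hεpos.le _)
    rw [mul_sum]
    refine (abs_sum_le_sum_abs _ _).trans (sum_le_sum fun i hi => ?_)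
    have hik : i < k := mem_range.1 hi
    rw [abs_mul, abs_of_pos hwpos]
    have hb := hval i z x
    rw [rpow_two_sub_natCast (P.spacing_pos i)] at hb
    -- the exponent bookkeeping
    have hLi : 0 < (P.L : ℝ) ^ i := pow_pos hLpos i
    have hLk : 0 < (P.L : ℝ) ^ k := pow_pos hLpos k
    have hLik : (P.L : ℝ) ^ i ≤ (P.L : ℝ) ^ k := pow_le_pow_right₀ (by exact_mod_cast P.L_pos) hik.le
    have hsp : δ * (P.spacing i)⁻¹ * (P.eps * (Site.tdist z x : ℝ)) = δ * (Site.tdist z x : ℝ) / (P.L : ℝ) ^ i := by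
      unfold Params.spacing; field_simp
    have hsd : (supDist x z : ℝ) ≤ (Site.tdist z x : ℝ) := by
      rw [B3TorusRadialSums.supDist_comm]; exact_mod_cast B3TorusRadialSums.supDist_le_tdist z x
    have hexp : w z * Real.exp (-(δ * (P.spacing i)⁻¹ * (P.eps * (Site.tdist z x : ℝ)))) ≤
        Real.exp (-(δ / 2 * (supDist x z : ℝ) / (P.L : ℝ) ^ i)) := by
      rw [hw, ← Real.exp_add, hsp]
      refine Real.exp_le_exp.2 ?_
      have h1 : t * (supDist x z : ℝ) / (P.L : ℝ) ^ k ≤ δ / 2 * (supDist x z : ℝ) / (P.L : ℝ) ^ i := by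
        rw [div_le_div_iff₀ hLk hLi]
        have hs0 : (0 : ℝ) ≤ supDist x z := Nat.cast_nonneg _
        calc t * (supDist x z : ℝ) * (P.L : ℝ) ^ i ≤ δ / 2 * (supDist x z : ℝ) * (P.L : ℝ) ^ i := by gcongr
          _ ≤ δ / 2 * (supDist x z : ℝ) * (P.L : ℝ) ^ k := by gcongr
      have h2 : -(δ * (Site.tdist z x : ℝ) / (P.L : ℝ) ^ i) ≤ -(δ * (supDist x z : ℝ) / (P.L : ℝ) ^ i) := by
        apply neg_le_neg; gcongr
      have e : -(δ / 2 * (supDist x z : ℝ) / (P.L : ℝ) ^ i) =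
          δ / 2 * (supDist x z : ℝ) / (P.L : ℝ) ^ i + -(δ * (supDist x z : ℝ) / (P.L : ℝ) ^ i) := by ring
      rw [e]; exact add_le_add h1 h2
    calc w z * |B3Sect3KernelsZeroTorus.gpiece P a 0 k i z x|
        ≤ w z * (C * (P.spacing i ^ 2 / P.spacing i ^ P.d) *
            Real.exp (-(δ * (P.spacing i)⁻¹ * (P.eps * (Site.tdist z x : ℝ))))) :=
          mul_le_mul_of_nonneg_left hb hwpos.le
      _ = C * (P.spacing i ^ 2 / P.spacing i ^ P.d) *
            (w z * Real.exp (-(δ * (P.spacing i)⁻¹ * (P.eps * (Site.tdist z x : ℝ))))) := by ring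
      _ ≤ C * (P.spacing i ^ 2 / P.spacing i ^ P.d) * Real.exp (-(δ / 2 * (supDist x z : ℝ) / (P.L : ℝ) ^ i)) :=
          mul_le_mul_of_nonneg_left hexp (mul_nonneg hC.le (div_nonneg (sq_nonneg _) (pow_nonneg (P.spacing_pos i).le _)))
      _ = C * f i z := by simp only [hf]; ring
  -- (P2) pointwise square with the weighted Cauchy–Schwarz over the scales
  have hP2 : ∀ z : Balaban1983to89.Site P 0,
      (w z * (tower P a 0).G k z x) ^ 2 ≤ (P.eps ^ P.d * C) ^ 2 * (Sq * ∑ i ∈ range k, (f i z) ^ 2 / q ^ i) := by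
    intro z
    have h1 : (w z * (tower P a 0).G k z x) ^ 2 ≤ (P.eps ^ P.d * C * ∑ i ∈ range k, f i z) ^ 2 := by
      rw [← sq_abs (w z * _)]
      exact pow_le_pow_left₀ (abs_nonneg _) (hP1 z) 2
    have hcs : (∑ i ∈ range k, f i z) ^ 2 ≤ Sq * ∑ i ∈ range k, (f i z) ^ 2 / q ^ i := by
      have h := Finset.sq_sum_div_le_sum_sq_div (range k) (fun i => f i z) (g := fun i => q ^ i) (fun i _ => pow_pos hqpos i)
      rwa [div_le_iff₀ hSq_pos, mul_comm] at h
    calc (w z * (tower P a 0).G k z x) ^ 2 ≤ (P.eps ^ P.d * C * ∑ i ∈ range k, f i z) ^ 2 := h1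
      _ = (P.eps ^ P.d * C) ^ 2 * (∑ i ∈ range k, f i z) ^ 2 := by ring
      _ ≤ (P.eps ^ P.d * C) ^ 2 * (Sq * ∑ i ∈ range k, (f i z) ^ 2 / q ^ i) :=
          mul_le_mul_of_nonneg_left hcs (sq_nonneg _)
  -- (P3) the `z`-sum of `f i z²` at each scale
  have hP3 : ∀ i : ℕ, ∑ z : Balaban1983to89.Site P 0, (f i z) ^ 2 / q ^ i ≤
      Kδ * (P.eps ^ 4 / P.eps ^ (2 * P.d)) * q ^ i := by
    intro i
    have hrad := sum_exp_neg_supDist_scale_le (P := P) hδ i x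
    have e1 : ∀ z : Balaban1983to89.Site P 0, (f i z) ^ 2 / q ^ i =
        (P.spacing i ^ 2 / P.spacing i ^ P.d) ^ 2 / q ^ i * Real.exp (-(δ * (supDist x z : ℝ) / (P.L : ℝ) ^ i)) := by
      intro z
      simp only [hf]
      rw [mul_pow, ← Real.exp_nat_mul]
      have e : ((2 : ℕ) : ℝ) * -(δ / 2 * (supDist x z : ℝ) / (P.L : ℝ) ^ i) = -(δ * (supDist x z : ℝ) / (P.L : ℝ) ^ i) := by
        push_cast; ring
      rw [e]; ring
    simp_rw [e1]
    rw [← mul_sum]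
    have hpref : 0 ≤ (P.spacing i ^ 2 / P.spacing i ^ P.d) ^ 2 / q ^ i := by positivity
    refine (mul_le_mul_of_nonneg_left hrad hpref).trans (le_of_eq ?_)
    have hsc := scale_identity hLpos hεpos (hd3.trans (by norm_num) : P.d ≤ 4) i
    have hspi : P.spacing i = (P.L : ℝ) ^ i * P.eps := rfl
    rw [hspi]
    calc (((P.L : ℝ) ^ i * P.eps) ^ 2 / ((P.L : ℝ) ^ i * P.eps) ^ P.d) ^ 2 / q ^ i *
          ((2 * (1 + (P.d : ℝ) / δ)) ^ P.d * ((P.L : ℝ) ^ i) ^ P.d)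
        = (2 * (1 + (P.d : ℝ) / δ)) ^ P.d *
            ((((P.L : ℝ) ^ i * P.eps) ^ 2 / ((P.L : ℝ) ^ i * P.eps) ^ P.d) ^ 2 * ((P.L : ℝ) ^ i) ^ P.d / q ^ i) := by ring
      _ = Kδ * (P.eps ^ 4 / P.eps ^ (2 * P.d) * q ^ i) := by rw [hsc]
      _ = Kδ * (P.eps ^ 4 / P.eps ^ (2 * P.d)) * q ^ i := by ring
  -- (P4) assemble
  have hmain : ∑ z, (w z * (tower P a 0).G k z x) ^ 2 ≤ C ^ 2 * Kδ * P.eps ^ 4 * Sq ^ 2 := by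
    calc ∑ z, (w z * (tower P a 0).G k z x) ^ 2
        ≤ ∑ z, (P.eps ^ P.d * C) ^ 2 * (Sq * ∑ i ∈ range k, (f i z) ^ 2 / q ^ i) := sum_le_sum fun z _ => hP2 z
      _ = (P.eps ^ P.d * C) ^ 2 * Sq * ∑ i ∈ range k, ∑ z, (f i z) ^ 2 / q ^ i := by
          rw [← mul_sum, sum_comm, ← mul_sum, mul_assoc]
      _ ≤ (P.eps ^ P.d * C) ^ 2 * Sq * ∑ i ∈ range k, Kδ * (P.eps ^ 4 / P.eps ^ (2 * P.d)) * q ^ i := by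
          gcongr with i hi
          exact hP3 i
      _ = C ^ 2 * Kδ * P.eps ^ 4 * Sq ^ 2 := by
          rw [← mul_sum, ← hSq]
          have hε : P.eps ^ (2 * P.d) = (P.eps ^ P.d) ^ 2 := by rw [pow_mul']
          rw [hε]
          have hεd : (P.eps ^ P.d) ^ 2 ≠ 0 := pow_ne_zero _ (pow_ne_zero _ hεpos.ne')
          field_simp
  -- the scale sum: `Sq ≤ q^k/(q−1)`, `Sq² ≤ L^{(4−d)k}/(q−1)²`, and `ε⁴L^{(4−d)k} = (L^kε)⁴/L^{kd}`
  have hq1' : q - 1 ≠ 0 := (sub_pos.2 hq1).ne'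
  have hSq_le : Sq ≤ q ^ k / (q - 1) := by
    rw [hSq, geom_sum_eq hq1.ne', div_le_div_iff_of_pos_right (sub_pos.2 hq1)]
    linarith [pow_pos hqpos k]
  have hSq2 : Sq ^ 2 ≤ (P.L : ℝ) ^ ((4 - P.d) * k) / (q - 1) ^ 2 := by
    have h := pow_le_pow_left₀ hSq_pos.le hSq_le 2
    rw [div_pow, ← pow_mul, mul_comm k 2, pow_mul, show q ^ 2 = (P.L : ℝ) ^ (4 - P.d) by
      rw [hq, Real.sq_sqrt (pow_nonneg (Nat.cast_nonneg _) _)], ← pow_mul] at h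
    exact h
  have hscale : P.eps ^ 4 * (P.L : ℝ) ^ ((4 - P.d) * k) = P.spacing k ^ 4 / (P.L : ℝ) ^ (k * P.d) := by
    have hspk : P.spacing k = (P.L : ℝ) ^ k * P.eps := rfl
    rw [hspk, mul_pow, ← pow_mul]
    have hLk : (P.L : ℝ) ^ (k * P.d) ≠ 0 := pow_ne_zero _ hLpos.ne'
    rw [eq_div_iff hLk]
    have e : (4 - P.d) * k + k * P.d = k * 4 := by
      have h4 : (4 - P.d) + P.d = 4 := Nat.sub_add_cancel (hd3.trans (by norm_num))
      calc (4 - P.d) * k + k * P.d = ((4 - P.d) + P.d) * k := by ring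
        _ = k * 4 := by rw [h4, mul_comm]
    calc P.eps ^ 4 * (P.L : ℝ) ^ ((4 - P.d) * k) * (P.L : ℝ) ^ (k * P.d)
        = P.eps ^ 4 * (P.L : ℝ) ^ ((4 - P.d) * k + k * P.d) := by rw [pow_add]; ring
      _ = (P.L : ℝ) ^ (k * 4) * P.eps ^ 4 := by rw [e]; ring
  calc ∑ z, (w z * (tower P a 0).G k z x) ^ 2 ≤ C ^ 2 * Kδ * P.eps ^ 4 * Sq ^ 2 := hmain
    _ ≤ C ^ 2 * Kδ * P.eps ^ 4 * ((P.L : ℝ) ^ ((4 - P.d) * k) / (q - 1) ^ 2) := by gcongr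
    _ = C ^ 2 * Kδ / (q - 1) ^ 2 * (P.eps ^ 4 * (P.L : ℝ) ^ ((4 - P.d) * k)) := by
        field_simp
    _ = C ^ 2 * Kδ / (q - 1) ^ 2 * (P.spacing k ^ 4 / (P.L : ℝ) ^ (k * P.d)) := by rw [hscale]

/-! ## §7 The tilted row bound of the free massive resolvent `R = (−Δ^ε + (L^kε)^{−2})⁻¹` (`d ≤ 3`) -/

/-- kernel: `(a + b)² ≤ 2a² + 2b²`. [folklore] -/
private theorem add_sq_le_two (a b : ℝ) : (a + b) ^ 2 ≤ 2 * a ^ 2 + 2 * b ^ 2 := by nlinarith [sq_nonneg (a - b)]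

/-- kernel: the row of the symmetric resolvent is its column: `R(x,z) = (R·δ_x)(z)`. [cite: Balaban1982Higgs1, (2.17) p.610] -/
theorem inv_H_apply_eq_mulVec_single (m : ℝ) (x z : Balaban1983to89.Site P 0) :
    (H P m)⁻¹ x z = ((H P m)⁻¹ *ᵥ Pi.single x (1 : ℝ)) z := by
  rw [mulVec_single, MulOpposite.op_one, one_smul, Matrix.col_apply]
  calc (H P m)⁻¹ x z = ((H P m)⁻¹)ᵀ z x := (transpose_apply _ _ _).symm
    _ = (H P m)⁻¹ z x := by rw [inv_H_transpose]

/-- **THE TILTED ROW BOUND OF THE FREE MASSIVE RESOLVENT** (`d ≤ 3`): with the mass `(L^kε)^{−2}` (one unit of mass on the `k`-th block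
scale) there are `t₀, C₀ > 0` (functions of `d, L, a`) such that for every volume, every `1 ≤ k ≤ K`, every `0 ≤ t ≤ t₀` and every site `x`,
`Σ_z e^{2t|x−z|_∞/L^k}·R(x,z)² ≤ C₀(L^kε)⁴L^{−kd}`, `R = (−Δ^ε + (L^kε)^{−2})⁻¹` — from the flat block propagator (§6) through the resolvent
identity (§4), the free Agmon bound (§3) and the tilted block-average bound (§4). This is the `ℓ² → ℓ^∞` smoothing input of the sup-norm
decay of the scalar propagator at non-flat backgrounds (sibling file `BIJ85ScalarPropagatorSupDecay`). [cite: BalabanImbrieJaffe1985, (7.3.2) p.326] -/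
theorem tilted_row_R_sq_le (d L : ℕ) (hd : 1 ≤ d) (hd3 : d ≤ 3) (hL : Odd L ∧ 1 < L) {a : ℝ} (ha : 0 < a) :
    ∃ t₀ C₀ : ℝ, 0 < t₀ ∧ 0 < C₀ ∧ ∀ (P : Params), P.d = d → P.L = L →
      ∀ k : ℕ, 1 ≤ k → k ≤ P.K → ∀ t : ℝ, 0 ≤ t → t ≤ t₀ → ∀ x : Balaban1983to89.Site P 0,
        ∑ z, (Real.exp (t * (supDist x z : ℝ) / (P.L : ℝ) ^ k) * (H P ((P.spacing k ^ 2)⁻¹))⁻¹ x z) ^ 2 ≤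
          C₀ * (P.spacing k ^ 4 / (P.L : ℝ) ^ (k * P.d)) := by
  obtain ⟨t₁, C₁, ht₁, hC₁, hG⟩ := tilted_row_G_sq_le d L hd hd3 hL ha
  refine ⟨min t₁ (1 / (2 * d)), (18 + 16 * a ^ 2 * Real.exp 1) * C₁, lt_min ht₁ (by positivity), by positivity, ?_⟩
  intro P hPd hPL k hk1 hkK t ht0 ht1 x
  have hG1 := hG P hPd hPL k hk1 hkK t ht0 (ht1.trans (min_le_left _ _)) x
  subst hPd; subst hPL
  have hk : k ≤ P.m + P.K := hkK.trans (Nat.le_add_left _ _)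
  have hLpos : (0 : ℝ) < P.L := P.cast_L_pos
  have hL1 : (1 : ℝ) < P.L := by exact_mod_cast hL.2
  have hεpos : 0 < P.eps := P.eps_pos
  have hsp : 0 < P.spacing k := P.spacing_pos k
  have htd : t ≤ 1 / (2 * P.d) := ht1.trans (min_le_right _ _)
  have hd1 : (1 : ℝ) ≤ P.d := by exact_mod_cast hd
  have ht12 : t ≤ 1 / 2 := htd.trans (by rw [div_le_div_iff₀ (by positivity) (by norm_num)]; linarith)
  -- the objects
  set sp : ℝ := P.spacing k with hspdef
  set m : ℝ := (sp ^ 2)⁻¹ with hm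
  have hmpos : 0 < m := by positivity
  set w : Balaban1983to89.Site P 0 → ℝ := fun z => Real.exp (t * (supDist x z : ℝ) / (P.L : ℝ) ^ k) with hw
  have hwpos : ∀ z, 0 < w z := fun z => Real.exp_pos _
  set QQ : Matrix (Balaban1983to89.Site P 0) (Balaban1983to89.Site P 0) ℝ := B1RG242Torus.Qks P k * B1RG242Torus.Qk P k with hQQ
  set α : ℝ := B1RG242Torus.α P a k with hα
  have hαeq : α = B1.aSeq a P.L k * (sp ^ 2)⁻¹ := rfl
  set u : Balaban1983to89.Site P 0 → ℝ := (tower P a 0).G k *ᵥ Pi.single x (1 : ℝ) with hu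
  have hu_apply : ∀ z, u z = (tower P a 0).G k z x := fun z => by
    rw [hu, mulVec_single, MulOpposite.op_one, one_smul, Matrix.col_apply]
  set v : Balaban1983to89.Site P 0 → ℝ := (α • QQ - m • (1 : Matrix _ _ ℝ)) *ᵥ u with hv
  -- the resolvent identity applied to `δ_x`
  have hRe : (H P m)⁻¹ *ᵥ Pi.single x (1 : ℝ) = u + (H P m)⁻¹ *ᵥ v := by
    conv_lhs => rw [resolvent_identity (P := P) ha hk1 hmpos (k := k)]
    rw [add_mulVec, hv, hu, mulVec_mulVec, mulVec_mulVec]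
  -- the weighted norm of `u` (§6)
  set Wu : ℝ := ∑ z, (w z * u z) ^ 2 with hWu
  have hWu_le : Wu ≤ C₁ * (sp ^ 4 / (P.L : ℝ) ^ (k * P.d)) := by
    rw [hWu]; simp_rw [hu_apply]; exact hG1
  have hWu_nn : 0 ≤ Wu := sum_nonneg fun z _ => sq_nonneg _
  -- (i) the block term: `W(QQu) ≤ e^{2t}W(u)`
  have hQQ : ∑ z, (w z * (QQ *ᵥ u) z) ^ 2 ≤ Real.exp (2 * t) * Wu :=
    tilted_sq_QQ_le hk hwpos (fun z z' hzz => weight_block_osc ht0 hk x z z' hzz) u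
  -- (ii) `W(v) ≤ (2α²e^{2t} + 2m²)W(u)`
  have hWv : ∑ z, (w z * v z) ^ 2 ≤ (2 * α ^ 2 * Real.exp (2 * t) + 2 * m ^ 2) * Wu := by
    have hpt : ∀ z, (w z * v z) ^ 2 ≤ 2 * α ^ 2 * (w z * (QQ *ᵥ u) z) ^ 2 + 2 * m ^ 2 * (w z * u z) ^ 2 := by
      intro z
      have e : v z = α * (QQ *ᵥ u) z - m * u z := by
        rw [hv, sub_mulVec, smul_mulVec, smul_mulVec, one_mulVec]
        simp only [Pi.sub_apply, Pi.smul_apply, smul_eq_mul]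
      rw [e, show w z * (α * (QQ *ᵥ u) z - m * u z) = α * (w z * (QQ *ᵥ u) z) + -(m * (w z * u z)) by ring]
      refine (add_sq_le_two _ _).trans (le_of_eq ?_); ring
    calc ∑ z, (w z * v z) ^ 2 ≤ ∑ z, (2 * α ^ 2 * (w z * (QQ *ᵥ u) z) ^ 2 + 2 * m ^ 2 * (w z * u z) ^ 2) := sum_le_sum fun z _ => hpt z
      _ = 2 * α ^ 2 * ∑ z, (w z * (QQ *ᵥ u) z) ^ 2 + 2 * m ^ 2 * Wu := by rw [sum_add_distrib, ← mul_sum, ← mul_sum]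
      _ ≤ 2 * α ^ 2 * (Real.exp (2 * t) * Wu) + 2 * m ^ 2 * Wu := by gcongr
      _ = (2 * α ^ 2 * Real.exp (2 * t) + 2 * m ^ 2) * Wu := by ring
  -- (iii) the free Agmon bound for `R v`
  set S₁ : ℝ := (t / (P.L : ℝ) ^ k) ^ 2 * Real.exp (t / (P.L : ℝ) ^ k) with hS₁
  have hS₁nn : 0 ≤ S₁ := by positivity
  have hLk : (1 : ℝ) ≤ (P.L : ℝ) ^ k := one_le_pow₀ hL1.le
  have hLkpos : (0 : ℝ) < (P.L : ℝ) ^ k := by positivity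
  -- `d·t²·e^{t/L^k} ≤ 1/2`
  have hsmallt : (P.d : ℝ) * t ^ 2 * Real.exp (t / (P.L : ℝ) ^ k) ≤ 1 / 2 := by
    have h1 : Real.exp (t / (P.L : ℝ) ^ k) ≤ Real.exp (1 / 2) :=
      Real.exp_le_exp.2 ((div_le_self ht0 hLk).trans ht12)
    have h2 : Real.exp (1 / 2 : ℝ) ≤ 2 := by
      have h1 := Real.exp_one_lt_d9
      have hsq : Real.exp (1 / 2 : ℝ) * Real.exp (1 / 2) = Real.exp 1 := by rw [← Real.exp_add]; norm_num
      nlinarith [Real.exp_pos (1 / 2 : ℝ)]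
    have h3 : (P.d : ℝ) * t ^ 2 ≤ 1 / 4 := by
      have ht' : t ≤ 1 / (2 * P.d) := htd
      have hdpos : (0 : ℝ) < P.d := by linarith
      have : t * (2 * P.d) ≤ 1 := by rwa [le_div_iff₀ (by positivity)] at ht'
      nlinarith [sq_nonneg t, mul_pos hdpos hdpos]
    calc (P.d : ℝ) * t ^ 2 * Real.exp (t / (P.L : ℝ) ^ k) ≤ (1 / 4) * 2 := by
          gcongr
          · exact h1.trans h2
      _ = 1 / 2 := by norm_num
  have hκ_eq : (P.d : ℝ) * (P.eps⁻¹) ^ 2 * S₁ = (P.d : ℝ) * t ^ 2 * Real.exp (t / (P.L : ℝ) ^ k) * m := by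
    have hspk : sp = (P.L : ℝ) ^ k * P.eps := rfl
    have e1 : (P.eps⁻¹) ^ 2 * (t / (P.L : ℝ) ^ k) ^ 2 = t ^ 2 * m := by
      rw [hm, hspk]; field_simp
    rw [hS₁]
    calc (P.d : ℝ) * (P.eps⁻¹) ^ 2 * ((t / (P.L : ℝ) ^ k) ^ 2 * Real.exp (t / (P.L : ℝ) ^ k))
        = (P.d : ℝ) * ((P.eps⁻¹) ^ 2 * (t / (P.L : ℝ) ^ k) ^ 2) * Real.exp (t / (P.L : ℝ) ^ k) := by ring
      _ = (P.d : ℝ) * t ^ 2 * Real.exp (t / (P.L : ℝ) ^ k) * m := by rw [e1]; ring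
  have hκ_le : (P.d : ℝ) * (P.eps⁻¹) ^ 2 * S₁ ≤ m / 2 := by
    rw [hκ_eq]; nlinarith only [hsmallt, hmpos]
  have hκ : (P.d : ℝ) * (P.eps⁻¹) ^ 2 * S₁ < m := by linarith only [hκ_le, hmpos]
  have hAg := agmon_free (P := P) hmpos hS₁nn hwpos (fun z μ => weight_bond_osc ht0 k x z μ) hκ v
  have hden : 4 * sp ^ 4 * (m - (P.d : ℝ) * (P.eps⁻¹) ^ 2 * S₁) ^ 2 ≥ 1 := by
    have h1 : m / 2 ≤ m - (P.d : ℝ) * (P.eps⁻¹) ^ 2 * S₁ := by linarith only [hκ_le]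
    have h2 : (m / 2) ^ 2 ≤ (m - (P.d : ℝ) * (P.eps⁻¹) ^ 2 * S₁) ^ 2 := pow_le_pow_left₀ (by positivity) h1 2
    have e : 4 * sp ^ 4 * (m / 2) ^ 2 = 1 := by rw [hm]; field_simp; ring
    calc 4 * sp ^ 4 * (m - (P.d : ℝ) * (P.eps⁻¹) ^ 2 * S₁) ^ 2 ≥ 4 * sp ^ 4 * (m / 2) ^ 2 :=
        mul_le_mul_of_nonneg_left h2 (by positivity)
      _ = 1 := e
  have hRv : ∑ z, (w z * ((H P m)⁻¹ *ᵥ v) z) ^ 2 ≤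
      4 * sp ^ 4 * ((2 * α ^ 2 * Real.exp (2 * t) + 2 * m ^ 2) * Wu) := by
    refine hAg.trans ?_
    have hpos : 0 < (m - (P.d : ℝ) * (P.eps⁻¹) ^ 2 * S₁) ^ 2 := by positivity
    rw [div_le_iff₀ hpos]
    have hnum_nn : 0 ≤ (2 * α ^ 2 * Real.exp (2 * t) + 2 * m ^ 2) * Wu := by positivity
    calc ∑ z, (w z * v z) ^ 2 ≤ (2 * α ^ 2 * Real.exp (2 * t) + 2 * m ^ 2) * Wu := hWv
      _ = (2 * α ^ 2 * Real.exp (2 * t) + 2 * m ^ 2) * Wu * 1 := (mul_one _).symm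
      _ ≤ (2 * α ^ 2 * Real.exp (2 * t) + 2 * m ^ 2) * Wu * (4 * sp ^ 4 * (m - (P.d : ℝ) * (P.eps⁻¹) ^ 2 * S₁) ^ 2) :=
          mul_le_mul_of_nonneg_left hden hnum_nn
      _ = 4 * sp ^ 4 * ((2 * α ^ 2 * Real.exp (2 * t) + 2 * m ^ 2) * Wu) * (m - (P.d : ℝ) * (P.eps⁻¹) ^ 2 * S₁) ^ 2 := by ring
  -- (iv) assemble
  have hsum : ∑ z, (w z * (H P m)⁻¹ x z) ^ 2 ≤ 2 * Wu + 2 * ∑ z, (w z * ((H P m)⁻¹ *ᵥ v) z) ^ 2 := by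
    calc ∑ z, (w z * (H P m)⁻¹ x z) ^ 2 = ∑ z, (w z * u z + w z * ((H P m)⁻¹ *ᵥ v) z) ^ 2 := by
          refine sum_congr rfl fun z _ => ?_
          rw [inv_H_apply_eq_mulVec_single, hRe, Pi.add_apply, mul_add]
      _ ≤ ∑ z, (2 * (w z * u z) ^ 2 + 2 * (w z * ((H P m)⁻¹ *ᵥ v) z) ^ 2) := sum_le_sum fun z _ => add_sq_le_two _ _
      _ = 2 * Wu + 2 * ∑ z, (w z * ((H P m)⁻¹ *ᵥ v) z) ^ 2 := by rw [sum_add_distrib, ← mul_sum, ← mul_sum]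
  clear_value u v α m sp
  have hα2 : sp ^ 4 * α ^ 2 ≤ a ^ 2 := by
    rw [hαeq]
    have h1 := B1.aSeq_le ha hL1 k hk1
    have h2 := (B1.aSeq_pos ha hL1 hk1).le
    have e : sp ^ 4 * (B1.aSeq a P.L k * (sp ^ 2)⁻¹) ^ 2 = B1.aSeq a P.L k ^ 2 := by field_simp
    rw [e]; exact pow_le_pow_left₀ h2 h1 2
  have hm2 : sp ^ 4 * m ^ 2 = 1 := by rw [hm]; field_simp
  have he2t : Real.exp (2 * t) ≤ Real.exp 1 := Real.exp_le_exp.2 (by linarith only [ht12])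
  have hcoef : 2 + 8 * (sp ^ 4 * (2 * α ^ 2 * Real.exp (2 * t) + 2 * m ^ 2)) ≤ 18 + 16 * a ^ 2 * Real.exp 1 := by
    have e : sp ^ 4 * (2 * α ^ 2 * Real.exp (2 * t) + 2 * m ^ 2) =
        2 * (sp ^ 4 * α ^ 2) * Real.exp (2 * t) + 2 * (sp ^ 4 * m ^ 2) := by ring
    rw [e, hm2]
    have h3 : (sp ^ 4 * α ^ 2) * Real.exp (2 * t) ≤ a ^ 2 * Real.exp 1 :=
      mul_le_mul hα2 he2t (Real.exp_pos _).le (sq_nonneg _)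
    linarith only [h3]
  have step2 : 2 * Wu + 2 * ∑ z, (w z * ((H P m)⁻¹ *ᵥ v) z) ^ 2 ≤
      2 * Wu + 2 * (4 * sp ^ 4 * ((2 * α ^ 2 * Real.exp (2 * t) + 2 * m ^ 2) * Wu)) :=
    add_le_add_right (mul_le_mul_of_nonneg_left hRv zero_le_two) _
  refine (hsum.trans step2).trans ?_
  calc 2 * Wu + 2 * (4 * sp ^ 4 * ((2 * α ^ 2 * Real.exp (2 * t) + 2 * m ^ 2) * Wu))
      = (2 + 8 * (sp ^ 4 * (2 * α ^ 2 * Real.exp (2 * t) + 2 * m ^ 2))) * Wu := by ring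
    _ ≤ (18 + 16 * a ^ 2 * Real.exp 1) * Wu := mul_le_mul_of_nonneg_right hcoef hWu_nn
    _ ≤ (18 + 16 * a ^ 2 * Real.exp 1) * (C₁ * (sp ^ 4 / (P.L : ℝ) ^ (k * P.d))) :=
        mul_le_mul_of_nonneg_left hWu_le (by positivity)
    _ = (18 + 16 * a ^ 2 * Real.exp 1) * C₁ * (sp ^ 4 / (P.L : ℝ) ^ (k * P.d)) := by ring

end

end Literature.MathematicalPhysics.QuantumFieldTheory.BalabanImbrieJaffe1984to88.BIJ85FreeResolventTiltedRow
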